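import Literature.Computability.QuantumComplexity.PathModelK5Sim
import Literature.Computability.QuantumComplexity.SU2DensityCriterion
import HarnessLib

/-!
# The one-qubit braid gates at `k = 5` generate a dense subgroup of `SU(2)`

Topic `Literature/Computability/QuantumComplexity`. In the four-strand encoding of a qubit
(Aharonov–Arad 2011 §3.1) the in-block braid generators act on the code space by the exact
`2 × 2` gates `blockCrossing r ε` (`PathModelEncodedQubits.lean`): at `k = 5`, with `A = ζ₅`,
`τ = φ - 1`,

  `ρ(σ₁) = ρ(σ₃) = diag(Aφ + A⁻¹, A⁻¹)`, `ρ(σ₂) = A [[τ, √τ], [√τ, 1]] + A⁻¹ · 1`.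

We prove that the determinant-one products `X = ρ(σ₁)ρ(σ₂)⁻¹`, `Y = ρ(σ₁)⁻¹ρ(σ₂)` satisfy the
hypotheses of the density criterion `SU2DensityCriterion.exists_word_near_of_det_eq_one`:
`tr(X)² = (5 - 3φ) det X` and the conjugate `3 - 3ψ > 2` of `tr(X)² - 2 = 3 - 3φ` certifies that
the eigenvalue ratio of `X` has infinite order (golden-ratio test); `Y` neither commutes with `X`
nor conjugates it to `X⁻¹`. All identities are decided in `K5 = ℤ[φ][ζ₅][√τ]` and transported by
`K5.toComplex`. Consequence (`exists_blockWord_near`): every element of `SU(2)` is approximated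
in operator norm by products of the one-qubit braid gates — the one-qubit half of the universality
underlying the `PromiseBQP`-hardness of the Jones polynomial at `k = 5` (Aharonov–Arad Thm. 3.1,
§4; Freedman–Larsen–Wang 2002).

## References

* D. Aharonov, I. Arad, New J. Phys. 13 (2011) 035019; arXiv:quant-ph/0605181, §3.1, §4
  [AharonovArad2011].
* D. Aharonov, V. Jones, Z. Landau, Algorithmica 55 (2009), §3.1 [AharonovJonesLandau2009].
-/

noncomputable section

namespace Literature.Computability.QuantumComplexity

open Matrix Complex Cryptography QuadraticAlgebra

local notation "U2" => Matrix.unitaryGroup (Fin 2) ℂ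

/-! ### `K5`-valued `2 × 2` matrices and their complex images -/

namespace K5

/-- The conjugate transpose over `K5` (complex conjugation `cconj` on entries). [folklore] -/
def adjK (M : Matrix (Fin 2) (Fin 2) K5) : Matrix (Fin 2) (Fin 2) K5 := Matrix.of fun i j => cconj (M j i)

/-- `toComplex` on matrices commutes with the adjoint. [folklore] -/
theorem map_adjK (M : Matrix (Fin 2) (Fin 2) K5) : (adjK M).map toComplex = star (M.map toComplex) := by
  ext i j
  rw [Matrix.star_eq_conjTranspose, conjTranspose_apply, map_apply, map_apply, adjK, of_apply, toComplex_cconj]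
  rfl

/-- `toComplex` on matrices is multiplicative. [folklore] -/
theorem map_mulK (M N : Matrix (Fin 2) (Fin 2) K5) :
    (M * N).map toComplex = M.map toComplex * N.map toComplex := Matrix.map_mul

/-- `toComplex` on matrices is injective. [folklore] -/
theorem map_injective {M N : Matrix (Fin 2) (Fin 2) K5} (h : M.map toComplex = N.map toComplex) : M = N :=
  Matrix.ext fun i j => toComplex_injective (by simpa using congr_fun (congr_fun h i) j)

/-- Trace through `toComplex`. [folklore] -/
theorem trace_mapK (M : Matrix (Fin 2) (Fin 2) K5) : (M.map toComplex).trace = toComplex M.trace := by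
  rw [Matrix.trace_fin_two, Matrix.trace_fin_two, map_apply, map_apply, map_add]

/-- Determinant through `toComplex`. [folklore] -/
theorem det_mapK (M : Matrix (Fin 2) (Fin 2) K5) : (M.map toComplex).det = toComplex M.det := by
  rw [Matrix.det_fin_two, Matrix.det_fin_two]; simp [map_apply]

/-- A `K5` matrix with `M · M† = 1` maps to a unitary. [folklore] -/
theorem map_mem_unitaryGroup {M : Matrix (Fin 2) (Fin 2) K5} (h : M * adjK M = 1) : M.map toComplex ∈ U2 := by
  rw [Matrix.mem_unitaryGroup_iff, ← map_adjK, ← map_mulK, h]; simp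

end K5

/-! ### The one-qubit braid gates over `K5` -/

/-- `ρ(σ₁)^{±1} = diag(A^{±1}φ + A^{∓1}, A^{∓1})` over `K5`. [cite: AharonovJonesLandau2009, §3.1] -/
def G0K (ε : Bool) : Matrix (Fin 2) (Fin 2) K5 :=
  !![K5.cw ε true * K5.ofPhi ZPhi.phi + K5.cw ε false, 0; 0, K5.cw ε false]

/-- `ρ(σ₂)^{±1} = A^{±1} [[τ, √τ], [√τ, 1]] + A^{∓1} 1` over `K5`. [cite: AharonovJonesLandau2009, §3.1] -/
def G1K (ε : Bool) : Matrix (Fin 2) (Fin 2) K5 :=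
  !![K5.cw ε true * K5.ofPhi ZPhi.tau + K5.cw ε false, K5.cw ε true * K5.sqrtTau;
     K5.cw ε true * K5.sqrtTau, K5.cw ε true + K5.cw ε false]

/-- The one-qubit braid gates reindexed to `Fin 2` (`|0⟩ ↦ 0`, `|1⟩ ↦ 1`). [cite: AharonovArad2011, §3.1] -/
def blockCrossing2 (r : Fin 3) (ε : Bool) : Matrix (Fin 2) (Fin 2) ℂ :=
  Matrix.reindex qRegOneEquiv qRegOneEquiv (blockCrossing r ε)

/-- `|0⟩ ≠ |1⟩` in `QReg 1`. [folklore] -/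
theorem qReg_one_false_ne_true : ((fun _ : Fin 1 => false) : QReg 1) ≠ fun _ => true :=
  fun h => by simpa using congr_fun h 0

/-- `|1⟩ ≠ |0⟩` in `QReg 1`. [folklore] -/
theorem qReg_one_true_ne_false : ((fun _ : Fin 1 => true) : QReg 1) ≠ fun _ => false :=
  fun h => by simpa using congr_fun h 0

/-- `λ₂/λ₁ = φ` in `ℂ`. [cite: AharonovJonesLandau2009, §3.1] -/
theorem ajlWeight_five_two_div_one_complex :
    ((ajlWeight 5 2 : ℝ) : ℂ) / ((ajlWeight 5 1 : ℝ) : ℂ) = (Real.goldenRatio : ℂ) := by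
  rw [← Complex.ofReal_div, ajlWeight_five_two_div_one]

/-- `λ₁/λ₂ = φ - 1` in `ℂ`. [cite: AharonovJonesLandau2009, §3.1] -/
theorem ajlWeight_five_one_div_two_complex :
    ((ajlWeight 5 1 : ℝ) : ℂ) / ((ajlWeight 5 2 : ℝ) : ℂ) = (Real.goldenRatio : ℂ) - 1 := by
  rw [← Complex.ofReal_div, ajlWeight_five_one_div_two]; push_cast; ring

/-- `λ₃/λ₂ = 1` in `ℂ`. [cite: AharonovJonesLandau2009, §3.1] -/
theorem ajlWeight_five_three_div_two_complex :
    ((ajlWeight 5 3 : ℝ) : ℂ) / ((ajlWeight 5 2 : ℝ) : ℂ) = 1 := by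
  rw [← Complex.ofReal_div, ajlWeight_five_three_div_two, Complex.ofReal_one]

/-- `√(λ₃λ₁)/λ₂ = √τ` in `ℂ`. [cite: AharonovJonesLandau2009, §3.1] -/
theorem sqrt_ajlWeight_div_complex :
    ((Real.sqrt (ajlWeight 5 3 * ajlWeight 5 1) : ℝ) : ℂ) / ((ajlWeight 5 2 : ℝ) : ℂ) = (ZPhiS.sqrtTau : ℂ) := by
  rw [← Complex.ofReal_div, sqrt_ajlWeight_five_three_mul_one_div_two]

/-- **`G0K` is `ρ(σ₁)`.** [cite: AharonovJonesLandau2009, §3.1] -/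
theorem map_G0K (ε : Bool) : (G0K ε).map K5.toComplex = blockCrossing2 0 ε := by
  ext i j
  fin_cases i <;> fin_cases j <;>
    simp [G0K, blockCrossing2, blockCrossing, blockPhi, Matrix.reindex_apply, K5.toComplex_cw, ZPhi.toReal_phi,
      ajlWeight_five_two_div_one_complex, Matrix.one_apply_ne, qReg_one_false_ne_true, qReg_one_true_ne_false]

/-- **`G1K` is `ρ(σ₂)`.** [cite: AharonovJonesLandau2009, §3.1] -/
theorem map_G1K (ε : Bool) : (G1K ε).map K5.toComplex = blockCrossing2 1 ε := by
  ext i j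
  fin_cases i <;> fin_cases j <;>
    simp [G1K, blockCrossing2, blockCrossing, blockPhi, Matrix.reindex_apply, K5.toComplex_cw, ZPhi.toReal_tau,
      K5.toComplex_sqrtTau, sqrt_ajlWeight_div_complex, ajlWeight_five_one_div_two_complex,
      ajlWeight_five_three_div_two_complex, Matrix.one_apply_ne, qReg_one_false_ne_true, qReg_one_true_ne_false]

/-- `ρ(σ^ε) ρ(σ^{¬ε}) = 1` for the one-qubit gates (over `K5`). [cite: AharonovJonesLandau2009, Def. 2.14] -/
theorem G0K_mul_not (ε : Bool) : G0K ε * G0K (!ε) = 1 := by cases ε <;> decide +kernel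

/-- `ρ(σ^ε) ρ(σ^{¬ε}) = 1` for the one-qubit gates (over `K5`). [cite: AharonovJonesLandau2009, Def. 2.14] -/
theorem G1K_mul_not (ε : Bool) : G1K ε * G1K (!ε) = 1 := by cases ε <;> decide +kernel

/-- The one-qubit gates are unitary (over `K5`). [cite: AharonovJonesLandau2009, Claim 3.2] -/
theorem G0K_mul_adjK (ε : Bool) : G0K ε * K5.adjK (G0K ε) = 1 := by cases ε <;> decide +kernel

/-- The one-qubit gates are unitary (over `K5`). [cite: AharonovJonesLandau2009, Claim 3.2] -/
theorem G1K_mul_adjK (ε : Bool) : G1K ε * K5.adjK (G1K ε) = 1 := by cases ε <;> decide +kernel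

/-! ### The two determinant-one elements -/

/-- `X = ρ(σ₁) ρ(σ₂)⁻¹` over `K5`. [cite: AharonovArad2011, §4] -/
def X1K : Matrix (Fin 2) (Fin 2) K5 := G0K true * G1K false

/-- `Y = ρ(σ₁)⁻¹ ρ(σ₂)` over `K5`. [cite: AharonovArad2011, §4] -/
def Y1K : Matrix (Fin 2) (Fin 2) K5 := G0K false * G1K true

/-- `det X = 1`. [cite: AharonovArad2011, §4] -/
theorem X1K_det : X1K.det = 1 := by decide +kernel

/-- `det Y = 1`. [cite: AharonovArad2011, §4] -/
theorem Y1K_det : Y1K.det = 1 := by decide +kernel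

/-- `X X† = 1`. [cite: AharonovArad2011, §4] -/
theorem X1K_mul_adjK : X1K * K5.adjK X1K = 1 := by decide +kernel

/-- `Y Y† = 1`. [cite: AharonovArad2011, §4] -/
theorem Y1K_mul_adjK : Y1K * K5.adjK Y1K = 1 := by decide +kernel

/-- **`tr(X)² = (5 - 3φ) · det X`**, i.e. `μ + μ⁻¹ = 3 - 3φ = -3τ` for the eigenvalue ratio of `X`.
[cite: AharonovArad2011, §4] -/
theorem X1K_trace_sq : X1K.trace * X1K.trace = (2 + K5.ofPhi ⟨3, -3⟩) * X1K.det := by decide +kernel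

/-- `Y X ≠ X Y`. [cite: AharonovArad2011, §4] -/
theorem Y1K_mul_X1K_ne : Y1K * X1K ≠ X1K * Y1K := by decide +kernel

/-- `Y X Y† ≠ X†` (`Y` does not conjugate `X` to its inverse). [cite: AharonovArad2011, §4] -/
theorem Y1K_conj_X1K_ne : Y1K * X1K * K5.adjK Y1K ≠ K5.adjK X1K := by decide +kernel

/-- `X` as an element of `U(2)`. [cite: AharonovArad2011, §4] -/
def X1U : U2 := ⟨X1K.map K5.toComplex, K5.map_mem_unitaryGroup X1K_mul_adjK⟩

/-- `Y` as an element of `U(2)`. [cite: AharonovArad2011, §4] -/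
def Y1U : U2 := ⟨Y1K.map K5.toComplex, K5.map_mem_unitaryGroup Y1K_mul_adjK⟩

/-- `det X = 1` in `ℂ`. [cite: AharonovArad2011, §4] -/
theorem X1U_det : (X1U : Matrix (Fin 2) (Fin 2) ℂ).det = 1 := by
  change (X1K.map K5.toComplex).det = 1
  rw [K5.det_mapK, X1K_det, map_one]

/-- `det Y = 1` in `ℂ`. [cite: AharonovArad2011, §4] -/
theorem Y1U_det : (Y1U : Matrix (Fin 2) (Fin 2) ℂ).det = 1 := by
  change (Y1K.map K5.toComplex).det = 1
  rw [K5.det_mapK, Y1K_det, map_one]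

/-- The conjugate of `3 - 3φ` is `3 - 3ψ > 2`. [folklore] -/
theorem two_lt_toConj_three : 2 < ZPhi.toConj ⟨3, -3⟩ := by
  rw [ZPhi.toConj_apply]
  change (2 : ℝ) < ((3 : ℤ) : ℝ) + ((-3 : ℤ) : ℝ) * Real.goldenConj
  push_cast
  linarith [Real.goldenConj_neg]

section Density

open scoped Matrix.Norms.L2Operator

/-- **Density of the one-qubit braid gates (criterion form)**: every `A ∈ SU(2)` is approximated
in operator norm by words in `X, Y, X⁻¹, Y⁻¹`. [cite: AharonovArad2011, §4] -/
theorem exists_XYword_near (A : U2) (hA : (A : Matrix (Fin 2) (Fin 2) ℂ).det = 1) {ε : ℝ} (hε : 0 < ε) :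
    ∃ w : List U2, (∀ x ∈ w, x ∈ ({X1U, Y1U, X1U⁻¹, Y1U⁻¹} : Set U2)) ∧
      ‖((w.prod : U2) : Matrix (Fin 2) (Fin 2) ℂ) - (A : Matrix (Fin 2) (Fin 2) ℂ)‖ < ε := by
  refine exists_word_near_of_det_eq_one X1U Y1U (K5.toComplex (2 + K5.ofPhi ⟨3, -3⟩)) ?_ ?_ ?_ ?_ A hA hε
  · -- trace identity
    change (X1K.map K5.toComplex).trace ^ 2 = _ * (X1K.map K5.toComplex).det
    rw [K5.trace_mapK, K5.det_mapK, sq, ← map_mul, ← map_mul, X1K_trace_sq]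
  · -- infinite order by the golden-ratio test
    intro μ hμ m hm
    refine pow_ne_one_of_add_inv_eq_toReal (c := ⟨3, -3⟩) ?_ two_lt_toConj_three hm
    rw [hμ, map_add, K5.toComplex_ofPhi, map_ofNat]; ring
  · -- non-commutation
    intro h
    have e := congrArg (fun U : U2 => (U : Matrix (Fin 2) (Fin 2) ℂ)) h
    simp only [Submonoid.coe_mul] at e
    change Y1K.map K5.toComplex * X1K.map K5.toComplex = X1K.map K5.toComplex * Y1K.map K5.toComplex at e
    rw [← K5.map_mulK, ← K5.map_mulK] at e
    exact Y1K_mul_X1K_ne (K5.map_injective e)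
  · -- `Y` does not conjugate `X` to `det X • X⁻¹`
    intro h
    rw [X1U_det, one_smul] at h
    change Y1K.map K5.toComplex * X1K.map K5.toComplex * star (Y1K.map K5.toComplex) = star (X1K.map K5.toComplex) at h
    rw [← K5.map_adjK, ← K5.map_adjK, ← K5.map_mulK, ← K5.map_mulK] at h
    exact Y1K_conj_X1K_ne (K5.map_injective h)

end Density

end Literature.Computability.QuantumComplexity

end
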